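import Summits.RiemannHypothesis.RiemannHypothesis.Theorems.SemilocalLogAtoms
import HarnessLib

/-!
# Semi-local negative certificates: the atoms `31, 37, 41, 43, 47` (enclosures, once and for all)

Cell `rh-explicit` (HOME `run/shared/lean/pub/rh-explicit/`), seat cc-s2-4 gen8 (A4-EXT, the Lean side: atom tables for the walls
`q = 37, 41, 43, 47, 53`, i.e. `S = {p < q}` on windows up to `b = 2`).  Companion of `SemilocalLogAtoms.lean` (atoms `2 … 16`) and
`SemilocalLogAtomsB.lean` (`17 … 29`, `32`, `49`): the rational atom table entries `(n, lo, hi, wlo, whi)` consumed by `WeilNegCertS` /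
`WeilNegCertP` for the primes `31, 37, 41, 43, 47`, each with its enclosure lemma for an ARBITRARY `S` containing the prime:

* `log 31` (1e-11), `log 37` (4.1e-10), `log 41` (2.1e-10), `log 43` (2.2e-10), `log 47` (2.1e-10) by Mathlib's
  `Real.abs_log_sub_add_sum_range_le` at `31 = 32(1 − 1/32)`, `37 = 36(1 + 1/36)`, `41 = 40(1 + 1/40)`, `43 = 42(1 + 1/42)`,
  `47 = 48(1 − 1/48)` (8–9 terms) with `log 2` (d20), `log 3`, `log 5` (Mathlib, 1e-10) and `log 7` (1e-11, `SemilocalLogAtoms`);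
* `√31, √37, √41, √43, √47` by squaring sixteen-digit decimals;
* atoms `atomThirtyOne … atomFortySeven` and the generic enclosure lemmas `atomThirtyOne_encl (h : 31 ∈ S)`, ….

Folklore numerics throughout; nothing here bears on RH.
-/

set_option autoImplicit false
set_option linter.dupNamespace false  -- the mandated namespace repeats `RiemannHypothesis`

noncomputable section

namespace Summit.RiemannHypothesis.RiemannHypothesis.Theorems.SemilocalPolyWitness

open Real
open Literature.NumberTheory.LFunctions
open Literature.Analysis.SpecialFunctions.Real
open Summit.RiemannHypothesis.RiemannHypothesis.Theorems.MotivicDoor.SemilocalMarkov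

/-! ### The atom `31` (`log 31` from `31 = 32·(1 − 1/32)`) -/

/-- `(3.43398720448) < log 31` (`Real.abs_log_sub_add_sum_range_le` at `x = 1/32`, 9 terms). -/
theorem log_thirtyone_gt : (3.43398720448 : ℝ) < Real.log 31 := by
  have t : |((1 : ℝ) / 32)| < 1 := by rw [abs_of_pos (by norm_num)]; norm_num
  have z := Real.abs_log_sub_add_sum_range_le t 9
  rw [abs_of_pos (by norm_num : (0 : ℝ) < 1 / 32)] at z
  norm_num [Finset.sum_range_succ] at z
  have e : Real.log (31 / 32) = Real.log 31 - (5 * Real.log 2) := by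
    rw [Real.log_div (by norm_num) (by norm_num), show (32 : ℝ) = 2 ^ 5 by norm_num, Real.log_pow]
    push_cast; ring
  rw [e] at z
  have h2 := Literature.Analysis.SpecialFunctions.Real.log_two_gt_d20
  obtain ⟨z1, z2⟩ := abs_le.1 z
  linarith

/-- `log 31 < 3.43398720449` (`Real.abs_log_sub_add_sum_range_le` at `x = 1/32`, 9 terms). -/
theorem log_thirtyone_lt : Real.log 31 < 3.43398720449 := by
  have t : |((1 : ℝ) / 32)| < 1 := by rw [abs_of_pos (by norm_num)]; norm_num
  have z := Real.abs_log_sub_add_sum_range_le t 9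
  rw [abs_of_pos (by norm_num : (0 : ℝ) < 1 / 32)] at z
  norm_num [Finset.sum_range_succ] at z
  have e : Real.log (31 / 32) = Real.log 31 - (5 * Real.log 2) := by
    rw [Real.log_div (by norm_num) (by norm_num), show (32 : ℝ) = 2 ^ 5 by norm_num, Real.log_pow]
    push_cast; ring
  rw [e] at z
  have h2 := Literature.Analysis.SpecialFunctions.Real.log_two_lt_d20
  obtain ⟨z1, z2⟩ := abs_le.1 z
  linarith

/-- lower decimal of `log 31` -/
def logThirtyOneLo : ℚ := 343398720448 / 100000000000
/-- upper decimal of `log 31` -/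
def logThirtyOneHi : ℚ := 343398720449 / 100000000000
/-- `logThirtyOneLo ≤ log 31`. -/
theorem logThirtyOneLo_le : (logThirtyOneLo : ℝ) ≤ Real.log 31 := by
  rw [logThirtyOneLo]; push_cast; linarith [log_thirtyone_gt]
/-- `log 31 ≤ logThirtyOneHi`. -/
theorem log_thirtyone_le_logThirtyOneHi : Real.log 31 ≤ (logThirtyOneHi : ℝ) := by
  rw [logThirtyOneHi]; push_cast; linarith [log_thirtyone_lt]
/-- `5.5677643628300219 ≤ √31 ≤ 5.567764362830022`. -/
def sqrtThirtyOneLo : ℚ := 55677643628300219 / 10000000000000000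
/-- upper decimal of `√31` -/
def sqrtThirtyOneHi : ℚ := 55677643628300220 / 10000000000000000
/-- The atom `31`: weight `log 31/√31`. -/
def atomThirtyOne : ℕ × AtomQ :=
  (31, ⟨logThirtyOneLo, logThirtyOneHi, logThirtyOneLo / sqrtThirtyOneHi, logThirtyOneHi / sqrtThirtyOneLo⟩)
/-- `atomThirtyOne` encloses the atom `31` for any `S ∋ 31`. -/
theorem atomThirtyOne_encl {S : Finset ℕ} (h : 31 ∈ S) :
    (atomThirtyOne.2.lo : ℝ) ≤ Real.log atomThirtyOne.1 ∧ Real.log atomThirtyOne.1 ≤ (atomThirtyOne.2.hi : ℝ) ∧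
      (atomThirtyOne.2.wlo : ℝ) ≤ weilSemilocalCoeff S atomThirtyOne.1 ∧
      weilSemilocalCoeff S atomThirtyOne.1 ≤ (atomThirtyOne.2.whi : ℝ) := by
  simp only [atomThirtyOne]
  push_cast
  have h0 := prime_atom_encl (by norm_num : Nat.Prime 31) h (lo := logThirtyOneLo) (hi := logThirtyOneHi)
    (slo := sqrtThirtyOneLo) (shi := sqrtThirtyOneHi) (by exact_mod_cast logThirtyOneLo_le)
    (by exact_mod_cast log_thirtyone_le_logThirtyOneHi) (by rw [logThirtyOneLo]; norm_num)
    (ratCast_le_sqrt (by rw [sqrtThirtyOneLo]; norm_num) (by rw [sqrtThirtyOneLo]; norm_num))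
    (sqrt_le_ratCast (by rw [sqrtThirtyOneHi]; norm_num) (by rw [sqrtThirtyOneHi]; norm_num))
    (by rw [sqrtThirtyOneLo]; norm_num)
  push_cast at h0
  exact h0

/-! ### The atom `37` (`log 37` from `37 = 36·(1 + 1/36)`) -/

/-- `(3.61091791244) < log 37` (`Real.abs_log_sub_add_sum_range_le` at `x = -1/36`, 9 terms). -/
theorem log_thirtyseven_gt : (3.61091791244 : ℝ) < Real.log 37 := by
  have t : |(-(1 : ℝ) / 36)| < 1 := by rw [abs_of_neg (by norm_num)]; norm_num
  have z := Real.abs_log_sub_add_sum_range_le t 9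
  rw [show |(-(1 : ℝ) / 36)| = 1 / 36 by rw [abs_of_neg (by norm_num)]; norm_num] at z
  norm_num [Finset.sum_range_succ] at z
  have e : Real.log (37 / 36) = Real.log 37 - (2 * Real.log 2 + 2 * Real.log 3) := by
    rw [Real.log_div (by norm_num) (by norm_num), show (36 : ℝ) = 2 ^ 2 * 3 ^ 2 by norm_num, Real.log_mul (by norm_num) (by norm_num), Real.log_pow, Real.log_pow]
    push_cast; ring
  rw [e] at z
  have h2 := Literature.Analysis.SpecialFunctions.Real.log_two_gt_d20
  have h3 := logThreeLo_le
  rw [logThreeLo] at h3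
  push_cast at h3
  obtain ⟨z1, z2⟩ := abs_le.1 z
  linarith

/-- `log 37 < 3.61091791285` (`Real.abs_log_sub_add_sum_range_le` at `x = -1/36`, 9 terms). -/
theorem log_thirtyseven_lt : Real.log 37 < 3.61091791285 := by
  have t : |(-(1 : ℝ) / 36)| < 1 := by rw [abs_of_neg (by norm_num)]; norm_num
  have z := Real.abs_log_sub_add_sum_range_le t 9
  rw [show |(-(1 : ℝ) / 36)| = 1 / 36 by rw [abs_of_neg (by norm_num)]; norm_num] at z
  norm_num [Finset.sum_range_succ] at z
  have e : Real.log (37 / 36) = Real.log 37 - (2 * Real.log 2 + 2 * Real.log 3) := by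
    rw [Real.log_div (by norm_num) (by norm_num), show (36 : ℝ) = 2 ^ 2 * 3 ^ 2 by norm_num, Real.log_mul (by norm_num) (by norm_num), Real.log_pow, Real.log_pow]
    push_cast; ring
  rw [e] at z
  have h2 := Literature.Analysis.SpecialFunctions.Real.log_two_lt_d20
  have h3 := log_three_le_logThreeHi
  rw [logThreeHi] at h3
  push_cast at h3
  obtain ⟨z1, z2⟩ := abs_le.1 z
  linarith

/-- lower decimal of `log 37` -/
def logThirtySevenLo : ℚ := 361091791244 / 100000000000
/-- upper decimal of `log 37` -/
def logThirtySevenHi : ℚ := 361091791285 / 100000000000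
/-- `logThirtySevenLo ≤ log 37`. -/
theorem logThirtySevenLo_le : (logThirtySevenLo : ℝ) ≤ Real.log 37 := by
  rw [logThirtySevenLo]; push_cast; linarith [log_thirtyseven_gt]
/-- `log 37 ≤ logThirtySevenHi`. -/
theorem log_thirtyseven_le_logThirtySevenHi : Real.log 37 ≤ (logThirtySevenHi : ℝ) := by
  rw [logThirtySevenHi]; push_cast; linarith [log_thirtyseven_lt]
/-- `6.0827625302982196 ≤ √37 ≤ 6.0827625302982197`. -/
def sqrtThirtySevenLo : ℚ := 60827625302982196 / 10000000000000000
/-- upper decimal of `√37` -/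
def sqrtThirtySevenHi : ℚ := 60827625302982197 / 10000000000000000
/-- The atom `37`: weight `log 37/√37`. -/
def atomThirtySeven : ℕ × AtomQ :=
  (37, ⟨logThirtySevenLo, logThirtySevenHi, logThirtySevenLo / sqrtThirtySevenHi, logThirtySevenHi / sqrtThirtySevenLo⟩)
/-- `atomThirtySeven` encloses the atom `37` for any `S ∋ 37`. -/
theorem atomThirtySeven_encl {S : Finset ℕ} (h : 37 ∈ S) :
    (atomThirtySeven.2.lo : ℝ) ≤ Real.log atomThirtySeven.1 ∧ Real.log atomThirtySeven.1 ≤ (atomThirtySeven.2.hi : ℝ) ∧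
      (atomThirtySeven.2.wlo : ℝ) ≤ weilSemilocalCoeff S atomThirtySeven.1 ∧
      weilSemilocalCoeff S atomThirtySeven.1 ≤ (atomThirtySeven.2.whi : ℝ) := by
  simp only [atomThirtySeven]
  push_cast
  have h0 := prime_atom_encl (by norm_num : Nat.Prime 37) h (lo := logThirtySevenLo) (hi := logThirtySevenHi)
    (slo := sqrtThirtySevenLo) (shi := sqrtThirtySevenHi) (by exact_mod_cast logThirtySevenLo_le)
    (by exact_mod_cast log_thirtyseven_le_logThirtySevenHi) (by rw [logThirtySevenLo]; norm_num)
    (ratCast_le_sqrt (by rw [sqrtThirtySevenLo]; norm_num) (by rw [sqrtThirtySevenLo]; norm_num))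
    (sqrt_le_ratCast (by rw [sqrtThirtySevenHi]; norm_num) (by rw [sqrtThirtySevenHi]; norm_num))
    (by rw [sqrtThirtySevenLo]; norm_num)
  push_cast at h0
  exact h0

/-! ### The atom `41` (`log 41` from `41 = 40·(1 + 1/40)`) -/

/-- `(3.71357206660) < log 41` (`Real.abs_log_sub_add_sum_range_le` at `x = -1/40`, 8 terms). -/
theorem log_fortyone_gt : (3.71357206660 : ℝ) < Real.log 41 := by
  have t : |(-(1 : ℝ) / 40)| < 1 := by rw [abs_of_neg (by norm_num)]; norm_num
  have z := Real.abs_log_sub_add_sum_range_le t 8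
  rw [show |(-(1 : ℝ) / 40)| = 1 / 40 by rw [abs_of_neg (by norm_num)]; norm_num] at z
  norm_num [Finset.sum_range_succ] at z
  have e : Real.log (41 / 40) = Real.log 41 - (3 * Real.log 2 + Real.log 5) := by
    rw [Real.log_div (by norm_num) (by norm_num), show (40 : ℝ) = 2 ^ 3 * 5 by norm_num, Real.log_mul (by norm_num) (by norm_num), Real.log_pow]
    push_cast; ring
  rw [e] at z
  have h2 := Literature.Analysis.SpecialFunctions.Real.log_two_gt_d20
  have h5 := logFiveLo_le
  rw [logFiveLo] at h5
  push_cast at h5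
  obtain ⟨z1, z2⟩ := abs_le.1 z
  linarith

/-- `log 41 < 3.71357206681` (`Real.abs_log_sub_add_sum_range_le` at `x = -1/40`, 8 terms). -/
theorem log_fortyone_lt : Real.log 41 < 3.71357206681 := by
  have t : |(-(1 : ℝ) / 40)| < 1 := by rw [abs_of_neg (by norm_num)]; norm_num
  have z := Real.abs_log_sub_add_sum_range_le t 8
  rw [show |(-(1 : ℝ) / 40)| = 1 / 40 by rw [abs_of_neg (by norm_num)]; norm_num] at z
  norm_num [Finset.sum_range_succ] at z
  have e : Real.log (41 / 40) = Real.log 41 - (3 * Real.log 2 + Real.log 5) := by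
    rw [Real.log_div (by norm_num) (by norm_num), show (40 : ℝ) = 2 ^ 3 * 5 by norm_num, Real.log_mul (by norm_num) (by norm_num), Real.log_pow]
    push_cast; ring
  rw [e] at z
  have h2 := Literature.Analysis.SpecialFunctions.Real.log_two_lt_d20
  have h5 := log_five_le_logFiveHi
  rw [logFiveHi] at h5
  push_cast at h5
  obtain ⟨z1, z2⟩ := abs_le.1 z
  linarith

/-- lower decimal of `log 41` -/
def logFortyOneLo : ℚ := 371357206660 / 100000000000
/-- upper decimal of `log 41` -/
def logFortyOneHi : ℚ := 371357206681 / 100000000000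
/-- `logFortyOneLo ≤ log 41`. -/
theorem logFortyOneLo_le : (logFortyOneLo : ℝ) ≤ Real.log 41 := by
  rw [logFortyOneLo]; push_cast; linarith [log_fortyone_gt]
/-- `log 41 ≤ logFortyOneHi`. -/
theorem log_fortyone_le_logFortyOneHi : Real.log 41 ≤ (logFortyOneHi : ℝ) := by
  rw [logFortyOneHi]; push_cast; linarith [log_fortyone_lt]
/-- `6.4031242374328486 ≤ √41 ≤ 6.4031242374328487`. -/
def sqrtFortyOneLo : ℚ := 64031242374328486 / 10000000000000000
/-- upper decimal of `√41` -/
def sqrtFortyOneHi : ℚ := 64031242374328487 / 10000000000000000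
/-- The atom `41`: weight `log 41/√41`. -/
def atomFortyOne : ℕ × AtomQ :=
  (41, ⟨logFortyOneLo, logFortyOneHi, logFortyOneLo / sqrtFortyOneHi, logFortyOneHi / sqrtFortyOneLo⟩)
/-- `atomFortyOne` encloses the atom `41` for any `S ∋ 41`. -/
theorem atomFortyOne_encl {S : Finset ℕ} (h : 41 ∈ S) :
    (atomFortyOne.2.lo : ℝ) ≤ Real.log atomFortyOne.1 ∧ Real.log atomFortyOne.1 ≤ (atomFortyOne.2.hi : ℝ) ∧
      (atomFortyOne.2.wlo : ℝ) ≤ weilSemilocalCoeff S atomFortyOne.1 ∧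
      weilSemilocalCoeff S atomFortyOne.1 ≤ (atomFortyOne.2.whi : ℝ) := by
  simp only [atomFortyOne]
  push_cast
  have h0 := prime_atom_encl (by norm_num : Nat.Prime 41) h (lo := logFortyOneLo) (hi := logFortyOneHi)
    (slo := sqrtFortyOneLo) (shi := sqrtFortyOneHi) (by exact_mod_cast logFortyOneLo_le)
    (by exact_mod_cast log_fortyone_le_logFortyOneHi) (by rw [logFortyOneLo]; norm_num)
    (ratCast_le_sqrt (by rw [sqrtFortyOneLo]; norm_num) (by rw [sqrtFortyOneLo]; norm_num))
    (sqrt_le_ratCast (by rw [sqrtFortyOneHi]; norm_num) (by rw [sqrtFortyOneHi]; norm_num))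
    (by rw [sqrtFortyOneLo]; norm_num)
  push_cast at h0
  exact h0

/-! ### The atom `43` (`log 43` from `43 = 42·(1 + 1/42)`) -/

/-- `(3.76120011559) < log 43` (`Real.abs_log_sub_add_sum_range_le` at `x = -1/42`, 8 terms). -/
theorem log_fortythree_gt : (3.76120011559 : ℝ) < Real.log 43 := by
  have t : |(-(1 : ℝ) / 42)| < 1 := by rw [abs_of_neg (by norm_num)]; norm_num
  have z := Real.abs_log_sub_add_sum_range_le t 8
  rw [show |(-(1 : ℝ) / 42)| = 1 / 42 by rw [abs_of_neg (by norm_num)]; norm_num] at z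
  norm_num [Finset.sum_range_succ] at z
  have e : Real.log (43 / 42) = Real.log 43 - (Real.log 2 + Real.log 3 + Real.log 7) := by
    rw [Real.log_div (by norm_num) (by norm_num), show (42 : ℝ) = 2 * 3 * 7 by norm_num, Real.log_mul (by norm_num) (by norm_num),
      Real.log_mul (by norm_num) (by norm_num)]
  rw [e] at z
  have h2 := Literature.Analysis.SpecialFunctions.Real.log_two_gt_d20
  have h3 := logThreeLo_le
  rw [logThreeLo] at h3
  push_cast at h3
  have h7 := logSevenLo_le
  rw [logSevenLo] at h7
  push_cast at h7
  obtain ⟨z1, z2⟩ := abs_le.1 z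
  linarith

/-- `log 43 < 3.76120011581` (`Real.abs_log_sub_add_sum_range_le` at `x = -1/42`, 8 terms). -/
theorem log_fortythree_lt : Real.log 43 < 3.76120011581 := by
  have t : |(-(1 : ℝ) / 42)| < 1 := by rw [abs_of_neg (by norm_num)]; norm_num
  have z := Real.abs_log_sub_add_sum_range_le t 8
  rw [show |(-(1 : ℝ) / 42)| = 1 / 42 by rw [abs_of_neg (by norm_num)]; norm_num] at z
  norm_num [Finset.sum_range_succ] at z
  have e : Real.log (43 / 42) = Real.log 43 - (Real.log 2 + Real.log 3 + Real.log 7) := by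
    rw [Real.log_div (by norm_num) (by norm_num), show (42 : ℝ) = 2 * 3 * 7 by norm_num, Real.log_mul (by norm_num) (by norm_num),
      Real.log_mul (by norm_num) (by norm_num)]
  rw [e] at z
  have h2 := Literature.Analysis.SpecialFunctions.Real.log_two_lt_d20
  have h3 := log_three_le_logThreeHi
  rw [logThreeHi] at h3
  push_cast at h3
  have h7 := log_seven_le_logSevenHi
  rw [logSevenHi] at h7
  push_cast at h7
  obtain ⟨z1, z2⟩ := abs_le.1 z
  linarith

/-- lower decimal of `log 43` -/
def logFortyThreeLo : ℚ := 376120011559 / 100000000000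
/-- upper decimal of `log 43` -/
def logFortyThreeHi : ℚ := 376120011581 / 100000000000
/-- `logFortyThreeLo ≤ log 43`. -/
theorem logFortyThreeLo_le : (logFortyThreeLo : ℝ) ≤ Real.log 43 := by
  rw [logFortyThreeLo]; push_cast; linarith [log_fortythree_gt]
/-- `log 43 ≤ logFortyThreeHi`. -/
theorem log_fortythree_le_logFortyThreeHi : Real.log 43 ≤ (logFortyThreeHi : ℝ) := by
  rw [logFortyThreeHi]; push_cast; linarith [log_fortythree_lt]
/-- `6.5574385243020006 ≤ √43 ≤ 6.5574385243020007`. -/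
def sqrtFortyThreeLo : ℚ := 65574385243020006 / 10000000000000000
/-- upper decimal of `√43` -/
def sqrtFortyThreeHi : ℚ := 65574385243020007 / 10000000000000000
/-- The atom `43`: weight `log 43/√43`. -/
def atomFortyThree : ℕ × AtomQ :=
  (43, ⟨logFortyThreeLo, logFortyThreeHi, logFortyThreeLo / sqrtFortyThreeHi, logFortyThreeHi / sqrtFortyThreeLo⟩)
/-- `atomFortyThree` encloses the atom `43` for any `S ∋ 43`. -/
theorem atomFortyThree_encl {S : Finset ℕ} (h : 43 ∈ S) :
    (atomFortyThree.2.lo : ℝ) ≤ Real.log atomFortyThree.1 ∧ Real.log atomFortyThree.1 ≤ (atomFortyThree.2.hi : ℝ) ∧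
      (atomFortyThree.2.wlo : ℝ) ≤ weilSemilocalCoeff S atomFortyThree.1 ∧
      weilSemilocalCoeff S atomFortyThree.1 ≤ (atomFortyThree.2.whi : ℝ) := by
  simp only [atomFortyThree]
  push_cast
  have h0 := prime_atom_encl (by norm_num : Nat.Prime 43) h (lo := logFortyThreeLo) (hi := logFortyThreeHi)
    (slo := sqrtFortyThreeLo) (shi := sqrtFortyThreeHi) (by exact_mod_cast logFortyThreeLo_le)
    (by exact_mod_cast log_fortythree_le_logFortyThreeHi) (by rw [logFortyThreeLo]; norm_num)
    (ratCast_le_sqrt (by rw [sqrtFortyThreeLo]; norm_num) (by rw [sqrtFortyThreeLo]; norm_num))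
    (sqrt_le_ratCast (by rw [sqrtFortyThreeHi]; norm_num) (by rw [sqrtFortyThreeHi]; norm_num))
    (by rw [sqrtFortyThreeLo]; norm_num)
  push_cast at h0
  exact h0

/-! ### The atom `47` (`log 47` from `47 = 48·(1 − 1/48)`) -/

/-- `(3.85014760161) < log 47` (`Real.abs_log_sub_add_sum_range_le` at `x = 1/48`, 8 terms). -/
theorem log_fortyseven_gt : (3.85014760161 : ℝ) < Real.log 47 := by
  have t : |((1 : ℝ) / 48)| < 1 := by rw [abs_of_pos (by norm_num)]; norm_num
  have z := Real.abs_log_sub_add_sum_range_le t 8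
  rw [abs_of_pos (by norm_num : (0 : ℝ) < 1 / 48)] at z
  norm_num [Finset.sum_range_succ] at z
  have e : Real.log (47 / 48) = Real.log 47 - (4 * Real.log 2 + Real.log 3) := by
    rw [Real.log_div (by norm_num) (by norm_num), show (48 : ℝ) = 2 ^ 4 * 3 by norm_num, Real.log_mul (by norm_num) (by norm_num), Real.log_pow]
    push_cast; ring
  rw [e] at z
  have h2 := Literature.Analysis.SpecialFunctions.Real.log_two_gt_d20
  have h3 := logThreeLo_le
  rw [logThreeLo] at h3
  push_cast at h3
  obtain ⟨z1, z2⟩ := abs_le.1 z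
  linarith

/-- `log 47 < 3.85014760182` (`Real.abs_log_sub_add_sum_range_le` at `x = 1/48`, 8 terms). -/
theorem log_fortyseven_lt : Real.log 47 < 3.85014760182 := by
  have t : |((1 : ℝ) / 48)| < 1 := by rw [abs_of_pos (by norm_num)]; norm_num
  have z := Real.abs_log_sub_add_sum_range_le t 8
  rw [abs_of_pos (by norm_num : (0 : ℝ) < 1 / 48)] at z
  norm_num [Finset.sum_range_succ] at z
  have e : Real.log (47 / 48) = Real.log 47 - (4 * Real.log 2 + Real.log 3) := by
    rw [Real.log_div (by norm_num) (by norm_num), show (48 : ℝ) = 2 ^ 4 * 3 by norm_num, Real.log_mul (by norm_num) (by norm_num), Real.log_pow]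
    push_cast; ring
  rw [e] at z
  have h2 := Literature.Analysis.SpecialFunctions.Real.log_two_lt_d20
  have h3 := log_three_le_logThreeHi
  rw [logThreeHi] at h3
  push_cast at h3
  obtain ⟨z1, z2⟩ := abs_le.1 z
  linarith

/-- lower decimal of `log 47` -/
def logFortySevenLo : ℚ := 385014760161 / 100000000000
/-- upper decimal of `log 47` -/
def logFortySevenHi : ℚ := 385014760182 / 100000000000
/-- `logFortySevenLo ≤ log 47`. -/
theorem logFortySevenLo_le : (logFortySevenLo : ℝ) ≤ Real.log 47 := by
  rw [logFortySevenLo]; push_cast; linarith [log_fortyseven_gt]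
/-- `log 47 ≤ logFortySevenHi`. -/
theorem log_fortyseven_le_logFortySevenHi : Real.log 47 ≤ (logFortySevenHi : ℝ) := by
  rw [logFortySevenHi]; push_cast; linarith [log_fortyseven_lt]
/-- `6.8556546004010441 ≤ √47 ≤ 6.8556546004010442`. -/
def sqrtFortySevenLo : ℚ := 68556546004010441 / 10000000000000000
/-- upper decimal of `√47` -/
def sqrtFortySevenHi : ℚ := 68556546004010442 / 10000000000000000
/-- The atom `47`: weight `log 47/√47`. -/
def atomFortySeven : ℕ × AtomQ :=
  (47, ⟨logFortySevenLo, logFortySevenHi, logFortySevenLo / sqrtFortySevenHi, logFortySevenHi / sqrtFortySevenLo⟩)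
/-- `atomFortySeven` encloses the atom `47` for any `S ∋ 47`. -/
theorem atomFortySeven_encl {S : Finset ℕ} (h : 47 ∈ S) :
    (atomFortySeven.2.lo : ℝ) ≤ Real.log atomFortySeven.1 ∧ Real.log atomFortySeven.1 ≤ (atomFortySeven.2.hi : ℝ) ∧
      (atomFortySeven.2.wlo : ℝ) ≤ weilSemilocalCoeff S atomFortySeven.1 ∧
      weilSemilocalCoeff S atomFortySeven.1 ≤ (atomFortySeven.2.whi : ℝ) := by
  simp only [atomFortySeven]
  push_cast
  have h0 := prime_atom_encl (by norm_num : Nat.Prime 47) h (lo := logFortySevenLo) (hi := logFortySevenHi)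
    (slo := sqrtFortySevenLo) (shi := sqrtFortySevenHi) (by exact_mod_cast logFortySevenLo_le)
    (by exact_mod_cast log_fortyseven_le_logFortySevenHi) (by rw [logFortySevenLo]; norm_num)
    (ratCast_le_sqrt (by rw [sqrtFortySevenLo]; norm_num) (by rw [sqrtFortySevenLo]; norm_num))
    (sqrt_le_ratCast (by rw [sqrtFortySevenHi]; norm_num) (by rw [sqrtFortySevenHi]; norm_num))
    (by rw [sqrtFortySevenLo]; norm_num)
  push_cast at h0
  exact h0

end Summit.RiemannHypothesis.RiemannHypothesis.Theorems.SemilocalPolyWitness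

end
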